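import Summits.QuantumFields.BalabanUV.Beta.EriceFlowEnclosureB12AsPrintedHistoryContagionShiftFlowZeroTangentSecondContDiff
import Summits.QuantumFields.BalabanUV.Beta.EriceFlowEnclosureB12AsPrintedHistoryContagionShiftFlowZeroTangentEnd

/-!
# Beta / EriceFlowEnclosureB12AsPrintedHistoryContagionShiftFlowZeroTangentSecondEnd — ASYMPTOTIC FREEDOM IS CONTAGIOUS, part 86: THE C² CARRIER END.  Part 74 (gen 42's END)
# carried the C¹ theory onto the carrier: `Theorem2Statement` AS TYPED + prover 1's `hrg` + NE4 + the history moduli + the C¹ letters ON THE LIMIT FUNCTIONAL `betaInf S.β` ⟹ for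
# every small reference coupling a C¹ Λ-coordinate of the continuum trajectories with the Gell-Mann–Low equation at every scale.  This part adds the C² letters of parts 78 ∕ 83
# ON THE LIMIT FUNCTIONAL — a Hessian `H` with `|H u j i| ≤ C_Hθ^jθ^i` (`hH`), the uniform second-order remainder (`hHB`), the uniform continuity of H (`hHc`), all EXPLICIT
# BINDERS — and concludes, on the same carrier and with the same thresholds: **the Λ-function `Λf` of the continuum trajectories is C² on ]0, g′[**, `Λf″(x) = −(3∕x)Λf′(x) +
# (4∕x⁶)V_∞(x)` with the second tangent limit of parts 78 ∕ 85, and **the continuous β-function `β₀∕Λf′` of part 74 is C¹ on ]0, g′[** — C² MEMORY OF THE LIMIT FUNCTIONAL ⟹ A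
# C² CONTINUUM RENORMALIZATION GROUP (READING).  Whether Bałaban's β_k (analytic in the couplings by construction, [I] §1) pass a gradient or a Hessian to `betaInf` is NOT
# PRINTED and NOT asserted; parts 73 and 85 show the letters are neither vacuous nor automatic
# (β-flow team, prover 1, unit `b2b-balaban-beta-bflow-p1`, gen 43; ROW AP-I·Uc × NODE U2)

HONEST FRAMING (page 1 of everything the β sub-cell writes): discharging `BetaPertH` makes Bałaban's UV stability UNCONDITIONAL — a
real constructive-QFT result; it is NOT the continuum limit and NOT the Clay problem.  HONEST DEPENDENCY (cell reorg 2026-08-19,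
verbatim): «continuum YM on T⁴ ⇐ BetaPertH ∧ nine spine estimates (0/9 proved); BetaPertH ⇐ (D1) ∧ (D4) ∧ CAP+tail; G-an2-4 gates
asym, D1 and NE2/3/4.»  THIS MODULE DISCHARGES NOTHING: bookkeeping over `B12BetaAsPrinted.Theorem2Statement` ([I] Thm 2 p. 259 AS TYPED — a HYPOTHESIS, STATED WITHOUT
PROOF in [I]), node U2's LETTERS `ScaleShiftRate` (NE4, GAPS G-t4-U2-1), `HistLipschitz` ∕ `FadingMemory` (G-t4-U2-2), prover 1's binder `hrg`, and parts 13, 35, 42, 44, 54,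
64–65, 70–71, 74, 85 of this series BY NAME (`reference_of_typedTheorem2`, `exists_valueAtZero`, `rate_le_valueAtZero`, `package_threshold_exists`, `relativeLambda_exists`,
`package_of_le`, `succ_le_of_reference_flow`, `rg_natCast_eq`, `differentiableAt_dynAbel`, `contDiffOn_two_dynAbel`, `differentiableOn_deriv_dynAbel`).  The C¹ ∕ C² letters
on `betaInf S.β` are EXPLICIT BINDERS (a CONDITIONAL reading).  NOTHING is asserted about Bałaban's actual β beyond these hypotheses; «β-function», «continuum renormalization
group» are OUR READING; NOT `BetaPertH`; NOT the continuum limit of gauge fields; NOT Clay.  [I] = T. Bałaban, Commun. Math. Phys. **109** (1987) 249–301 [Balaban1987RG1].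

WHAT THIS FILE PROVES (0 sorry, 0 def): §158 **`contDiff_two_rg_of_typedTheorem2`**.
-/

namespace Summit.QuantumFields.BalabanUV.Beta.EriceFlowEnclosureB12AsPrintedHistoryContagionShiftFlowZeroTangentSecondEnd

open Finset Filter Topology Set Function MeasureTheory
open Literature.MathematicalPhysics.QuantumFieldTheory.Balaban1983to89
open Literature.MathematicalPhysics.QuantumFieldTheory.Balaban1983to89.B12BetaAsPrinted
open Literature.MathematicalPhysics.QuantumFieldTheory.Balaban1983to89.FlowStep (RGEqH HBeta)
open Literature.MathematicalPhysics.QuantumFieldTheory.Balaban1983to89.T4CouplingMatching (HistLipschitz FadingMemory ScaleShiftRate sprof)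
open Literature.MathematicalPhysics.QuantumFieldTheory.Balaban1983to89.T4ContinuumCoupling (gstar)
open Literature.MathematicalPhysics.QuantumFieldTheory.Balaban1983to89.T4BetaStationary (SeqBox MemoryProfile betaInf memoryProfile_betaInf)
open Literature.MathematicalPhysics.QuantumFieldTheory.Balaban1983to89.T4BetaFlowWellPosed (MemFlow solution)
open Summit.QuantumFields.BalabanUV.Beta.EriceFlowEnclosureB12AsPrintedHistoryContagionShiftFlowPicardEnd (reference_of_typedTheorem2)
open Summit.QuantumFields.BalabanUV.Beta.EriceFlowEnclosureB12AsPrintedHistoryContagionShiftFlowZero (exists_valueAtZero rate_le_valueAtZero)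
open Summit.QuantumFields.BalabanUV.Beta.EriceFlowEnclosureB12AsPrintedHistoryContagionShiftFlowZeroOffset (package_of_le succ_le_of_reference_flow)
open Summit.QuantumFields.BalabanUV.Beta.EriceFlowEnclosureB12AsPrintedHistoryContagionShiftFlowZeroLambda (relativeLambda_exists)
open Summit.QuantumFields.BalabanUV.Beta.EriceFlowEnclosureB12AsPrintedHistoryContagionShiftFlowZeroEnd (package_threshold_exists)
open Summit.QuantumFields.BalabanUV.Beta.EriceFlowEnclosureB12AsPrintedHistoryContagionShiftFlowZeroSemigroup (rg_natCast_eq)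
open Summit.QuantumFields.BalabanUV.Beta.EriceFlowEnclosureB12AsPrintedHistoryContagionShiftFlowZeroTangentLambda (differentiableAt_dynAbel)
open Summit.QuantumFields.BalabanUV.Beta.EriceFlowEnclosureB12AsPrintedHistoryContagionShiftFlowZeroTangentSecondDeriv (differentiableOn_deriv_dynAbel)
open Summit.QuantumFields.BalabanUV.Beta.EriceFlowEnclosureB12AsPrintedHistoryContagionShiftFlowZeroTangentSecondContDiff (contDiffOn_two_dynAbel)

noncomputable section

variable {S : Setting}

/-! ## §158 Theorem 2 AS TYPED + a C² limit functional: the Λ-coordinate of the continuum trajectories is C² and the β-function is C¹ -/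

/-- **THEOREM 2 AS TYPED + A C² LIMIT FUNCTIONAL ⟹ A C² Λ-COORDINATE AND A C¹ β-FUNCTION ON THE CARRIER.**  `Theorem2Statement S hL` (a HYPOTHESIS), `hrg` on ]0, γ_u], NE4
`ScaleShiftRate c θ γ_u S.β` (c ≥ 0), `HistLipschitz Λ γ_u S.β` with `FadingMemory C θ Λ` (0 < θ < 1, C ≥ 0), the C¹ letters of parts 68 ∕ 71 (`hG`, `hGB`) and the C² letters of
parts 78 ∕ 83 (`hH` with `C_H ≥ 0`, `hHB`, `hHc`) for the LIMIT functional `betaInf S.β`.  THEN there are β₀ > 0, `b ∈ ]0, β₀]` and, for every m, g₂₅ > 0 such that for every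
reference coupling `g′ ≤ g₂₅` with a Theorem-2-type family `rows′` there is `Λf`, `Λf g′ = 0`, strictly antitone on ]0, g′], with: (orbits) `invFunOn Λf (Ioc 0 g′) (Λf g + kβ₀) =
gstar rows k` for every admissible family pinned at `g ≤ g′`; (C²) **`ContDiffOn ℝ 2 Λf (Ioo 0 g′)`**, `Λf′ < 0` on ]0, g′[, and at every `x ∈ ]0, g′[` a second tangent limit
`V_∞` with **`Λf″(x) = −(3∕x)Λf′(x) + (4∕x⁶)V_∞`**; (β-function) **`ContDiffOn ℝ 1 (x ↦ β₀∕Λf′(x)) (Ioo 0 g′)`**.  [cite: Balaban1987RG1, Thm 2 (0.31) p.259 with (0.20) p.256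
and §5 p.298] -/
theorem contDiff_two_rg_of_typedTheorem2 {hL : Odd S.L ∧ 1 < S.L} (h : Theorem2Statement S hL)
    {γu θ C CH c : ℝ} {Λ : ℕ → ℕ → ℝ} {G : (ℕ → ℝ) → ℕ → ℝ} {H : (ℕ → ℝ) → ℕ → ℕ → ℝ} (hγu : 0 < γu)
    (hrg : ∀ P : B12.RunParams, Step.InInterval γu P.K (S.cpl P) → RGEqH P.K S.β (S.cpl P))
    (hS : ScaleShiftRate c θ γu S.β) (hL' : HistLipschitz Λ γu S.β) (hΛ : FadingMemory C θ Λ)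
    (hθ0 : 0 < θ) (hθ1 : θ < 1) (hC : 0 ≤ C) (hCH : 0 ≤ CH) (hc : 0 ≤ c)
    (hG : ∀ u : ℕ → ℝ, SeqBox γu u → ∀ j, |G u j| ≤ C * θ ^ j)
    (hGB : ∀ ε > 0, ∃ ρ > 0, ∀ u u' : ℕ → ℝ, SeqBox γu u → SeqBox γu u' → (∀ j, |u' j - u j| ≤ ρ) →
      |betaInf S.β u' - betaInf S.β u - ∑' j, G u j * (u' j - u j)| ≤ ε * ∑' j, θ ^ j * |u' j - u j|)
    (hH : ∀ u : ℕ → ℝ, SeqBox γu u → ∀ j i, |H u j i| ≤ CH * θ ^ j * θ ^ i)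
    (hHB : ∀ ε > 0, ∃ ρ > 0, ∀ u u' : ℕ → ℝ, SeqBox γu u → SeqBox γu u' → (∀ j, |u' j - u j| ≤ ρ) →
      ∀ j, |G u' j - G u j - ∑' i, H u j i * (u' i - u i)| ≤ ε * θ ^ j * ∑' i, θ ^ i * |u' i - u i|)
    (hHc : ∀ ε > 0, ∃ ρ > 0, ∀ u u' : ℕ → ℝ, SeqBox γu u → SeqBox γu u' → (∀ j, |u' j - u j| ≤ ρ) → ∀ j i, |H u' j i - H u j i| ≤ ε * θ ^ j * θ ^ i)
    (m : ℕ) :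
    ∃ β₀ b g₂₅ : ℝ, 0 < b ∧ b ≤ β₀ ∧ 0 < g₂₅ ∧ (∀ u : ℕ → ℝ, SeqBox γu u → |betaInf S.β u - β₀| ≤ C * ∑' j, θ ^ j * u j) ∧
      ∀ (g' : ℝ) (rows' : ℕ → ℕ → ℝ), 0 < g' → g' ≤ g₂₅ →
      (∀ K, ∃ (m' : ℕ) (g₀ : ℝ), rows' K = S.cpl ⟨K, m', g₀⟩) → (∀ K, Step.InInterval γu K (rows' K)) → (∀ K, rows' K K = g') →
      ∃ Λf : ℝ → ℝ, Λf g' = 0 ∧ StrictAntiOn Λf (Ioc 0 g') ∧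
        (∀ (g : ℝ) (rows : ℕ → ℕ → ℝ), 0 < g → g ≤ g' →
          (∀ K, ∃ (m' : ℕ) (g₀ : ℝ), rows K = S.cpl ⟨K, m', g₀⟩) → (∀ K, Step.InInterval γu K (rows K)) → (∀ K, rows K K = g) →
          ∀ k : ℕ, invFunOn Λf (Ioc 0 g') (Λf g + (k : ℝ) * β₀) = gstar rows k) ∧
        ContDiffOn ℝ 2 Λf (Ioo 0 g') ∧
        (∀ x ∈ Ioo (0 : ℝ) g', deriv Λf x < 0 ∧ ∃ Winf Vinf : ℝ, deriv Λf x = Winf * (-2 / x ^ 3) ∧ deriv (deriv Λf) x = -(3 / x) * deriv Λf x + 4 / x ^ 6 * Vinf) ∧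
        ContDiffOn ℝ 1 (fun x : ℝ => β₀ / deriv Λf x) (Ioo 0 g') := by
  have h1θ : 0 < 1 - θ := by linarith
  have hB := memoryProfile_betaInf hS hL' hΛ hθ0.le hθ1
  obtain ⟨β₀, h0⟩ := exists_valueAtZero hB hC hθ0.le hθ1 hγu
  obtain ⟨gr, b, g₂, -, t, hgr, hb, hg₂, -, htbox, htflow, hprof, hmem, -⟩ :=
    reference_of_typedTheorem2 h hγu hrg hS hL' hΛ hθ0 hθ1 hC hc m
  have h2gr : 0 < 2 * gr := by positivity
  have hbβ : b ≤ β₀ := rate_le_valueAtZero hC hθ0.le hθ1 hb h2gr h0 htbox htflow hprof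
  have hβ₀ : 0 < β₀ := hb.trans_le hbβ
  obtain ⟨e₀, he₀, hthr⟩ := package_threshold_exists (1 / gr ^ 2 + C * γu / (1 - θ) ^ 2 + (2 * C / ((1 - θ) * b)) ^ 2) hC hθ1 hb
  refine ⟨β₀, b, min e₀ (min g₂ (γu / 2)), hb, hbβ, lt_min he₀ (lt_min hg₂ (by positivity)), h0, fun g' rows' hg' hle hrow' hI' hpin' => ?_⟩
  obtain ⟨hs1, hs2, hs4, hs5⟩ := hthr g' hg' (hle.trans (min_le_left _ _))
  have hle2' : g' ≤ g₂ := hle.trans ((min_le_right _ _).trans (min_le_left _ _))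
  have h2g' : 2 * g' ≤ γu := by linarith [hle.trans ((min_le_right _ _).trans (min_le_right _ _))]
  have hγ : 0 ≤ γu := hγu.le
  obtain ⟨hbox', hflow'⟩ := hmem rows' g' hrow' hI' hpin' hle2'
  obtain ⟨Λf, hΛ0, hΛh, -, hanti, -, habel, huniq⟩ :=
    relativeLambda_exists hB hC hθ0.le hθ1 hb h2gr h0 htbox htflow hprof hg' h2g' hs1 hs2 hs4 hs5 hbox' hflow'
  have hdyn : ∀ e ∈ Ioc (0 : ℝ) g', ∀ hh : ℕ → ℝ, SeqBox γu hh → MemFlow (betaInf S.β) e hh →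
      Tendsto (fun n => 1 / hh n ^ 2 - 1 / (gstar rows' n) ^ 2) atTop (𝓝 (Λf e)) := hΛh
  have honto : ∀ y : ℝ, Λf g' ≤ y → ∃ x ∈ Ioc (0 : ℝ) g', Λf x = y := by
    intro y hy
    rw [hΛ0] at hy
    obtain ⟨x, ⟨hx, hxy⟩, -⟩ := huniq y hy
    exact ⟨x, hx, hxy⟩
  obtain ⟨hC2, hC1d, -, -⟩ := contDiffOn_two_dynAbel hB hC hθ0.le hθ1 hb h2gr htbox htflow hprof hG hGB hCH hH hHB hHc hdyn h2g' hs1 hs2 hs4 hs5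
  obtain ⟨-, hkey⟩ := differentiableOn_deriv_dynAbel hB hC hθ0.le hθ1 hb h2gr htbox htflow hprof hG hGB hCH hH hHB hdyn h2g' hs1 hs2 hs4 hs5
  have hneg : ∀ x ∈ Ioo (0 : ℝ) g', deriv Λf x < 0 := fun x hx =>
    (differentiableAt_dynAbel hB hC hθ0.le hθ1 hb h2gr htbox htflow hprof hG hGB hdyn h2g' hs1 hs2 hs4 hs5 hx).2.1
  refine ⟨Λf, hΛ0, hanti, fun g rows hg hgg' hrow hI hpin k => ?_, hC2, fun x hx => ?_, ?_⟩
  · -- the integer times are the continuum running coupling (part 74's argument verbatim)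
    obtain ⟨hbox, hflow⟩ := hmem rows g hrow hI hpin (hgg'.trans hle2')
    have hgmem : g ∈ Ioc (0 : ℝ) g' := ⟨hg, hgg'⟩
    obtain ⟨p1, p2, -, -⟩ := package_of_le hC hθ1 hb hγ hg hgg' hs1 hs2 hs4 hs5
    have hkmem : ∀ k, gstar rows k ∈ Ioc (0 : ℝ) g' := fun k =>
      ⟨(hbox k).1, (succ_le_of_reference_flow hB hC hθ0.le hθ1 hb h2gr h0 htbox htflow hprof hbox hflow p1 p2 k).2.2.trans hgg'⟩
    exact rg_natCast_eq hanti honto hβ₀.le hgmem hkmem (habel g hgmem _ hbox hflow) k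
  · obtain ⟨Winf, Vinf, -, hd1, hd2⟩ := hkey x hx
    exact ⟨hneg x hx, Winf, Vinf, hd1, hd2⟩
  · -- the β-function β₀∕Λf′ is C¹: a C¹ non-vanishing denominator
    exact contDiffOn_const.div hC1d fun x hx => (hneg x hx).ne

end

end Summit.QuantumFields.BalabanUV.Beta.EriceFlowEnclosureB12AsPrintedHistoryContagionShiftFlowZeroTangentSecondEnd
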